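import Summits.QuantumFields.BalabanUV.T4Continuum.Support.NE7K1LinTorusChart
import Summits.QuantumFields.BalabanUV.T4Continuum.Support.NE7K1LinTwoRunUpper

/-!
# NE7K1LinSchurFoldBox — row NE7 (node U5), candidate route HOM, path H1L, cell K1-lin(s): I2 IN KERNEL — THE NEUMANN-BOX
# TWO-CUTOFF LINE (in particular the hard block-mean Schur complement `K_L`) IS THE 2^{d+1}-IMAGE FOLD OF THE DOUBLED-TORUS
# LINE (NEEDS-ESTIMATE #E1 «REG-LINE(s)», input I2 of lens 2 — assembled)

Lineage `b2b-balaban-t4-ne7-p2` (CRUX PROVER NE7 #2), generation 72; file 34 — the assembly of files 30–33.  PRICING-NE7 v29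
§216 (N-30-1): #E1 = R-E1 ⊕ B-E1 ⊕ I2 ⊕ I3 (I3 ✓ file 28); I2 = t4-ne7-idea-2 g58 `I2I3-SUPPLY.md` §2 «K^Π(y₀, y) =
Σ_{τ ∈ {id,ρ}^D} K^𝕋(y₀, τy), ρt = 2M−1−t» (EXACT in `ℚ` ×7 by the desk, 13∕13 by lens 1; on paper XS via group averaging).

THE OBJECTS (mesh `n ≥ 1`, refinement `L ≥ 1`, `M_μ ≥ 1` big blocks per side, any coupling `a`):
* the fine Neumann box `Π′ = boxDom ((nL)·M)` and its `L`-block labels `Π = Π′.image (blk L) = boxDom (n·M)` — run B's and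
  run A's lattices; the tree's two-cutoff line `twoCutoffLine _ n a s` on `Π` (`NE7K1LinSchurLineU1`; at `s = 1` the hard Schur
  complement `P_B^{Schur}`, at `a = 0, s = 1` the `K_L` of file 28);
* the fine doubled torus `𝕋′ = boxDom (dbl ((nL)·M))` (representatives) and its labels `𝕋 = boxDom (dbl (n·M))`; the TORUS
  LINE `torLine _ n a N_f N_c s = (1−s)·torOpK n a N_c 𝕋 + s·schurC (torB)` — the same construction with the periodic operators
  of files 32–33;
* the unfold matrix `E_c = unfoldM (n·M) 𝕋 Π`, `E_c(x, y) = [fold x = y]`.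

THE THEOREMS:
* §2 **`torLine_mul_unfoldM`**: `torLine(s) · E_c = E_c · twoCutoffLine(s)` for EVERY `s`, every `a ≥ 0`, every mesh — file 30's
  «LEMMA F» `lineOpR_intertwine` fed with file 32's three intertwinings and file 33's Schur data (all BY NAME).
* §3 **`twoCutoffLine_fold_apply`** — THE IMAGES FORM: `T^Π(s)(fold x₀, y) = Σ_{x ∈ 𝕋, fold x = y} T^𝕋(s)(x₀, x)`; at a box point
  `x₀ = y₀` and `a = 0`, `s = 1` this is literally lens 2's I2 for `K_L` (**`schurKL_fold_apply`**); **`fibre_eq_image_reflBox`**: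
  the torus points over `y` are EXACTLY the `2^{d+1}` reflections `σ_ε y`, `ε ∈ {0,1}^{d+1}` (`ρ_μ t = 2N_μ − 1 − t`), pairwise
  distinct — so the sum is lens 2's `Σ_{τ ∈ {id,ρ}^D}`.
* §4 for `a > 0`, `s ∈ [0,1]` both lines are invertible (`isUnit_det_torLine`) and the GREEN's FUNCTIONS fold the same way:
  **`twoCutoffLine_inv_fold_apply`** `G^Π(s)(fold x₀, y) = Σ_{fold x = y} G^𝕋(s)(x₀, x)` — B4 (2.42)'s method of images for the whole
  K1-lin(s) line, in its finite (doubled-torus) form.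
(File 35 `NE7K1LinSchurFoldForms`: quadratic forms transfer through the fold — `E_cᵀE_c = 2^{d+1}·1`, Löwner floors descend.)

HONEST FRAMING: [folklore]; a finite identity — NO estimate (what it buys is located: #E1's box side reduces to the torus side
EXACTLY, for the line and its propagator, at every `s` and `a`); nothing of Bałaban's asserted; no `sorry`.  Census only: N-30-1's
input I2 moves from «EXACT numerically ∕ XS on paper» to KERNEL; #E1 stays OPEN (R-E1 ⊕ B-E1 untouched); no letter ∕ tag ∕ size of
NE7 moves by this file.  NE7 NOT PRINTED ∕ NOT PROVED; spine 0∕9; FIXED FINITE T⁴, rung (B)+1; NOT infinite volume, NOT mass gap,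
NOT Clay.  HONEST DEPENDENCY: continuum YM on T⁴ ⇐ BetaPertH ∧ nine spine estimates (0/9 proved); BetaPertH ⇐ (D1) ∧ (D4) ∧
CAP+tail; G-an2-4 gates asym, D1 and NE2/3/4.
-/

noncomputable section

open Finset Matrix

namespace Summit.QuantumFields.BalabanUV.T4Continuum.NE7K1LinSchurFoldBox

open Literature.MathematicalPhysics.QuantumFieldTheory.Balaban1983to89
open Literature.MathematicalPhysics.QuantumFieldTheory.Balaban1983to89.B4Reflection242
open Literature.MathematicalPhysics.QuantumFieldTheory.Balaban1983to89.B4Lower18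
open NE7K1LinFoldKernels NE7K1LinFoldMatrices NE7K1LinSchurFold NE7K1LinTorusChart NE7K1LinBlockCoords
  NE7K1LinSchurLineU1 NE7K1LinSchurLineForm NE7K1LinSchurLineCoords NE7K1LinWalkLine NE7K1LinTwoRunUpper NE7K1LinTwoRunKit

variable {d : ℕ}

/-! ### §1 The fine box, the fine doubled torus, their labels -/

section Setup

variable {n L : ℕ} {M : Fin (d + 1) → ℕ}

/-- `(nL)·M = L·(n·M)` coordinatewise. [folklore] -/
theorem side_eq (n L : ℕ) (M : Fin (d + 1) → ℕ) : (fun i => n * L * M i) = fun i => L * (n * M i) :=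
  funext fun i => by ring

/-- `1 ≤ nL`. [folklore] -/
theorem one_le_mul (hn : 1 ≤ n) (hL : 1 ≤ L) : 1 ≤ n * L :=
  Nat.one_le_iff_ne_zero.2 (Nat.mul_ne_zero (by omega) (by omega))

/-- the fine box `Π′ = boxDom ((nL)·M)` is a union of `nL`-blocks. [folklore] -/
theorem fineBox_isBlockUnion (hn : 1 ≤ n) (hL : 1 ≤ L) (M : Fin (d + 1) → ℕ) :
    IsBlockUnion (n * L) (boxDom fun i => n * L * M i) :=
  boxDom_isBlockUnion (one_le_mul hn hL) M

/-- the fine doubled torus `𝕋′ = boxDom (dbl ((nL)·M))` is a union of `nL`-blocks. [folklore] -/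
theorem fineTor_isBlockUnion (hn : 1 ≤ n) (hL : 1 ≤ L) (M : Fin (d + 1) → ℕ) :
    IsBlockUnion (n * L) (boxDom (dbl fun i => n * L * M i)) := by
  rw [dbl_mul]
  exact boxDom_isBlockUnion (one_le_mul hn hL) _

/-- the fine box in the scale-`L` form. [folklore] -/
theorem fineBox_eq (n L : ℕ) (M : Fin (d + 1) → ℕ) : boxDom (fun i => n * L * M i) = boxDom (fun i => L * (n * M i)) := by
  rw [side_eq]

/-- the fine torus in the scale-`L` form. [folklore] -/
theorem fineTor_eq (n L : ℕ) (M : Fin (d + 1) → ℕ) :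
    boxDom (dbl fun i => n * L * M i) = boxDom (dbl fun i => L * (n * M i)) := by
  rw [side_eq]

/-- the `L`-block labels of the fine box: `Π = boxDom (n·M)`. [folklore] -/
theorem image_fineBox (hL : 1 ≤ L) (n : ℕ) (M : Fin (d + 1) → ℕ) :
    (boxDom fun i => n * L * M i).image (blk L) = boxDom (fun i => n * M i) := by
  rw [fineBox_eq, image_blk_boxDom hL]

/-- the `L`-block labels of the fine torus: `𝕋 = boxDom (dbl (n·M))`. [folklore] -/
theorem image_fineTor (hL : 1 ≤ L) (n : ℕ) (M : Fin (d + 1) → ℕ) :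
    (boxDom (dbl fun i => n * L * M i)).image (blk L) = boxDom (dbl fun i => n * M i) := by
  rw [fineTor_eq, image_blk_dbl hL]

/-- a box is contained in its doubled torus' representatives. [folklore] -/
theorem boxDom_subset_dbl (N : Fin (d + 1) → ℕ) : boxDom N ⊆ boxDom (dbl N) := by
  intro x hx
  rw [mem_boxDom] at hx ⊢
  intro i
  have := hx i
  simp only [dbl_apply]
  push_cast
  constructor <;> linarith

end Setup

/-! ### §2 The torus line and THE INTERTWINING `torLine(s)·E_c = E_c·twoCutoffLine(s)` -/

section Line

variable {n L : ℕ} [NeZero L] {T : Finset (Fin (d + 1) → ℤ)}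

/-- **THE TWO-CUTOFF LINE ON THE DOUBLED TORUS**: `(1−s)·torOpK n a N_c 𝕋 + s·(A₁ − BD⁻¹C)` over the blocks of run B's torus
chart operator `torB _ n a N_f` — the tree's `twoCutoffLine` with the periodic operators. [folklore] -/
def torLine (hTL : IsBlockUnion L T) (n : ℕ) (a : ℝ) (Nf Nc : Fin (d + 1) → ℕ) (s : ℝ) :
    Matrix ↥(T.image (blk L)) ↥(T.image (blk L)) ℝ :=
  lineOpR (torOpK n a Nc (T.image (blk L))) (torB hTL n a Nf).toBlocks₁₁ (torB hTL n a Nf).toBlocks₁₂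
    (torB hTL n a Nf).toBlocks₂₁ (torB hTL n a Nf).toBlocks₂₂ s

variable {M : Fin (d + 1) → ℕ}

/-- **I2 IN KERNEL — THE NEUMANN-BOX LINE IS THE FOLD OF THE DOUBLED-TORUS LINE**: for every `s`, every `a ≥ 0`, every mesh `n ≥ 1`
and every box of `M_μ ≥ 1` big blocks, `torLine(s) · E_c = E_c · twoCutoffLine(s)` with `E_c(x, y) = [fold x = y]`. [folklore] -/
theorem torLine_mul_unfoldM (hn : 1 ≤ n) {a : ℝ} (ha : 0 ≤ a) (hM : ∀ i, 1 ≤ M i) (s : ℝ) :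
    torLine (isBlockUnion_fine (fineTor_isBlockUnion hn (NeZero.one_le : 1 ≤ L) M)) n a (fun i => n * L * M i)
        (fun i => n * M i) s *
      unfoldM (fun i => n * M i) ((boxDom (dbl fun i => n * L * M i)).image (blk L))
        ((boxDom fun i => n * L * M i).image (blk L)) =
    unfoldM (fun i => n * M i) ((boxDom (dbl fun i => n * L * M i)).image (blk L))
        ((boxDom fun i => n * L * M i).image (blk L)) *
      twoCutoffLine (isBlockUnion_fine (fineBox_isBlockUnion hn (NeZero.one_le : 1 ≤ L) M)) n a s := by
  have hL : 1 ≤ L := NeZero.one_le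
  have hnL : 1 ≤ n * L := one_le_mul hn hL
  have hNc : ∀ i, 1 ≤ (fun i => n * M i) i := mul_pos_side hn hM
  have hNf : ∀ i, 1 ≤ (fun i => n * L * M i) i := mul_pos_side hnL hM
  set hB' := fineBox_isBlockUnion hn hL M
  set hT' := fineTor_isBlockUnion hn hL M
  have hLpow : ((L : ℝ) ^ (d + 1)) ≠ 0 := pow_ne_zero _ (by exact_mod_cast (NeZero.ne L))
  -- the three intertwinings (file 32) and the coarse one
  have hME := torOpK_mul_unfoldM hnL a hM (F := boxDom (dbl fun i => n * L * M i)) (G := boxDom fun i => n * L * M i) rfl rfl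
  have hSE := bsum_mul_unfoldM hL hNc (F := boxDom (dbl fun i => n * L * M i)) (G := boxDom fun i => n * L * M i)
    (fineTor_eq n L M) (fineBox_eq n L M)
  have hES := unfoldM_mul_bsum_transpose hL hNc (F := boxDom (dbl fun i => n * L * M i)) (G := boxDom fun i => n * L * M i)
    (fineTor_eq n L M) (fineBox_eq n L M)
  rw [← side_eq n L M] at hSE hES
  have hPE := torOpK_mul_unfoldM hn a hM (F := (boxDom (dbl fun i => n * L * M i)).image (blk L))
    (G := (boxDom fun i => n * L * M i).image (blk L)) (image_fineTor hL n M) (image_fineBox hL n M)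
  -- the Schur data (file 33) and LEMMA F (file 30)
  unfold torLine torB twoCutoffLine
  exact lineOpR_intertwine (c := ((L : ℝ) ^ (d + 1))⁻¹) (ℓ := (L : ℝ) ^ (d + 1))
    (bsum_coordT (isBlockUnion_fine hB')) (coordT_surj (isBlockUnion_fine hB'))
    (bsum_coordT (isBlockUnion_fine hT')) (coordT_surj (isBlockUnion_fine hT')) hLpow
    (isUnit_det_runB_fluct hn hB' ha) (isUnit_det_torB_fluct hn hT' rfl hNf ha) hME hSE hES hPE s

end Line

/-! ### §3 The images form; `K_L`; the images are the `2^{d+1}` reflections -/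

section Images

variable {n L : ℕ} [NeZero L] {M : Fin (d + 1) → ℕ}

/-- folding a torus label lands in the box labels. [folklore] -/
theorem foldBox_mem_image (hn : 1 ≤ n) (hM : ∀ i, 1 ≤ M i) (x : Fin (d + 1) → ℤ) :
    foldBox (fun i => n * M i) x ∈ (boxDom fun i => n * L * M i).image (blk L) := by
  rw [image_fineBox NeZero.one_le n M]
  exact foldBox_mem_boxDom (mul_pos_side hn hM) x

/-- **THE IMAGES FORM OF I2**: `T^Π(s)(fold x₀, y) = Σ_{x ∈ 𝕋, fold x = y} T^𝕋(s)(x₀, x)` for every torus label `x₀` and box label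
`y`. [folklore] -/
theorem twoCutoffLine_fold_apply (hn : 1 ≤ n) {a : ℝ} (ha : 0 ≤ a) (hM : ∀ i, 1 ≤ M i) (s : ℝ)
    (x₀ : ↥((boxDom (dbl fun i => n * L * M i)).image (blk L))) (y : ↥((boxDom fun i => n * L * M i).image (blk L))) :
    twoCutoffLine (isBlockUnion_fine (fineBox_isBlockUnion hn (NeZero.one_le : 1 ≤ L) M)) n a s
        ⟨foldBox (fun i => n * M i) x₀.1, foldBox_mem_image hn hM x₀.1⟩ y =
      ∑ x ∈ Finset.univ.filter (fun x : ↥((boxDom (dbl fun i => n * L * M i)).image (blk L)) =>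
          foldBox (fun i => n * M i) x.1 = y.1),
        torLine (isBlockUnion_fine (fineTor_isBlockUnion hn (NeZero.one_le : 1 ≤ L) M)) n a (fun i => n * L * M i)
          (fun i => n * M i) s x₀ x := by
  classical
  set f : ↥((boxDom (dbl fun i => n * L * M i)).image (blk L)) → ↥((boxDom fun i => n * L * M i).image (blk L)) :=
    fun x => ⟨foldBox (fun i => n * M i) x.1, foldBox_mem_image hn hM x.1⟩ with hf
  have hE : unfoldM (fun i => n * M i) ((boxDom (dbl fun i => n * L * M i)).image (blk L))
      ((boxDom fun i => n * L * M i).image (blk L)) = Matrix.of fun x y => if f x = y then (1 : ℝ) else 0 := by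
    ext x y'
    simp only [unfoldM_apply, Matrix.of_apply, hf, Subtype.ext_iff]
  have h := torLine_mul_unfoldM hn ha hM s (L := L)
  rw [hE] at h
  have h2 := apply_fold_eq_sum_of_intertwine f h x₀ y
  rw [show f x₀ = ⟨foldBox (fun i => n * M i) x₀.1, foldBox_mem_image hn hM x₀.1⟩ from rfl] at h2
  rw [h2]
  refine Finset.sum_congr (Finset.filter_congr fun x _ => ?_) fun _ _ => rfl
  rw [hf, Subtype.ext_iff]

/-- the box labels embed in the torus labels (a box point is its own representative). [folklore] -/
theorem mem_image_tor_of_mem {y : Fin (d + 1) → ℤ} (hy : y ∈ (boxDom fun i => n * L * M i).image (blk L)) :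
    y ∈ (boxDom (dbl fun i => n * L * M i)).image (blk L) := by
  rw [image_fineBox NeZero.one_le n M] at hy
  rw [image_fineTor NeZero.one_le n M]
  exact boxDom_subset_dbl _ hy

/-- **LENS 2's I2 FOR `K_L` LITERALLY**: at `a = 0`, `s = 1` (the hard block-mean Schur complement of file 28) and a box label `y₀`,
`K_L^Π(y₀, y) = Σ_{x ∈ 𝕋, fold x = y} K_L^𝕋(y₀, x)`. [folklore] -/
theorem schurKL_fold_apply (hn : 1 ≤ n) (hM : ∀ i, 1 ≤ M i)
    (y₀ y : ↥((boxDom fun i => n * L * M i).image (blk L))) :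
    twoCutoffLine (isBlockUnion_fine (fineBox_isBlockUnion hn (NeZero.one_le : 1 ≤ L) M)) n 0 1 y₀ y =
      ∑ x ∈ Finset.univ.filter (fun x : ↥((boxDom (dbl fun i => n * L * M i)).image (blk L)) =>
          foldBox (fun i => n * M i) x.1 = y.1),
        torLine (isBlockUnion_fine (fineTor_isBlockUnion hn (NeZero.one_le : 1 ≤ L) M)) n 0 (fun i => n * L * M i)
          (fun i => n * M i) 1 ⟨y₀.1, mem_image_tor_of_mem y₀.2⟩ x := by
  have hy₀ : foldBox (fun i => n * M i) y₀.1 = y₀.1 := by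
    have h := y₀.2
    simp only [image_fineBox NeZero.one_le n M] at h
    exact (mem_boxDom_iff_fold (mul_pos_side hn hM) _).1 h
  have h := twoCutoffLine_fold_apply hn le_rfl hM 1 ⟨y₀.1, mem_image_tor_of_mem y₀.2⟩ y
  have e : (⟨foldBox (fun i => n * M i) y₀.1, foldBox_mem_image hn hM y₀.1⟩ :
      ↥((boxDom fun i => n * L * M i).image (blk L))) = y₀ := Subtype.ext hy₀
  rw [e] at h
  exact h

/-- the reflection of the box in the doubled torus along the directions `ε`: `σ_ε = reflBox N ε [ε]` (`ρ_μ t = 2N_μ − 1 − t` where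
`ε_μ`, identity elsewhere). [folklore] -/
theorem reflBox_mem_dbl {N : Fin (d + 1) → ℕ} (ε : Fin (d + 1) → Bool) {y : Fin (d + 1) → ℤ} (hy : y ∈ boxDom N) :
    reflBox N ε (fun i => if ε i then 1 else 0) y ∈ boxDom (dbl N) := by
  rw [mem_boxDom] at hy ⊢
  intro i
  have := hy i
  simp only [reflBox_apply, refl1Fun, dbl_apply]
  push_cast
  cases ε i <;> simp <;> constructor <;> linarith

/-- **THE IMAGES OVER A BOX POINT ARE THE `2^{d+1}` REFLECTIONS**: `{x ∈ 𝕋 : fold x = y} = {σ_ε y : ε ∈ {0,1}^{d+1}}`. [folklore] -/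
theorem fibre_eq_image_reflBox {N : Fin (d + 1) → ℕ} (hN : ∀ i, 1 ≤ N i) {y : Fin (d + 1) → ℤ} (hy : y ∈ boxDom N) :
    (boxDom (dbl N)).filter (fun x => foldBox N x = y) =
      Finset.univ.image (fun ε : Fin (d + 1) → Bool => reflBox N ε (fun i => if ε i then 1 else 0) y) := by
  classical
  have hfy : foldBox N y = y := (mem_boxDom_iff_fold hN y).1 hy
  ext x
  simp only [Finset.mem_filter, Finset.mem_image, Finset.mem_univ, true_and]
  constructor
  · rintro ⟨hx, hfx⟩
    refine ⟨bitsOf N x, ?_⟩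
    have e := reflBox_foldBox N x
    rw [hfx] at e
    have hm : mulsOf N x = fun i => if bitsOf N x i then 1 else 0 := by
      funext i
      have hxi := (mem_boxDom.1 hx) i
      simp only [dbl_apply] at hxi
      push_cast at hxi
      have hmod : x i % (2 * (N i : ℤ)) = x i := Int.emod_eq_of_lt hxi.1 hxi.2
      simp only [mulsOf, mulOf, bitsOf, bitOf, hmod]
      by_cases h : x i < N i
      · rw [if_pos h]
        have : decide ((N i : ℤ) ≤ x i) = false := by simp; omega
        rw [this]; simp
        exact Int.ediv_eq_zero_of_lt hxi.1 hxi.2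
      · rw [if_neg h]
        have : decide ((N i : ℤ) ≤ x i) = true := by simp; omega
        rw [this]; simp
        exact Int.ediv_eq_zero_of_lt hxi.1 hxi.2
    rw [← hm]
    exact e
  · rintro ⟨ε, rfl⟩
    exact ⟨reflBox_mem_dbl ε hy, by rw [foldBox_reflBox hN, hfy]⟩

/-- the `2^{d+1}` reflections of a point are pairwise distinct. [folklore] -/
theorem reflBox_eps_injective {N : Fin (d + 1) → ℕ} (hN : ∀ i, 1 ≤ N i) (y : Fin (d + 1) → ℤ) :
    Function.Injective fun ε : Fin (d + 1) → Bool => reflBox N ε (fun i => if ε i then 1 else 0) y :=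
  fun _ _ h => (reflBox_inj hN y h).1

/-- hence exactly `2^{d+1}` torus labels fold onto each box label. [folklore] -/
theorem card_fibre {N : Fin (d + 1) → ℕ} (hN : ∀ i, 1 ≤ N i) {y : Fin (d + 1) → ℤ} (hy : y ∈ boxDom N) :
    ((boxDom (dbl N)).filter (fun x => foldBox N x = y)).card = 2 ^ (d + 1) := by
  classical
  rw [fibre_eq_image_reflBox hN hy, Finset.card_image_of_injective _ (reflBox_eps_injective hN y), Finset.card_univ,
    Fintype.card_pi, Finset.prod_const, Fintype.card_bool, Finset.card_univ, Fintype.card_fin]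

end Images

/-! ### §4 Green's functions: for `a > 0` both lines are invertible and the propagators fold the same way -/

section Green

variable {n L : ℕ} [NeZero L] {M : Fin (d + 1) → ℕ}

/-- the box line is invertible for `a > 0`, `s ∈ [0,1]` (the tree's `twoCutoff_inv_decay` at `δ = 0`). [folklore] -/
theorem isUnit_det_twoCutoffLine (hn : 1 ≤ n) {a : ℝ} (ha : 0 < a) (M : Fin (d + 1) → ℕ) {s : ℝ} (hs0 : 0 ≤ s) (hs1 : s ≤ 1)
    (x : ↥((boxDom fun i => n * L * M i).image (blk L))) :
    IsUnit (twoCutoffLine (isBlockUnion_fine (fineBox_isBlockUnion hn (NeZero.one_le : 1 ≤ L) M)) n a s).det := by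
  have hL0 : (0 : ℝ) < L := by exact_mod_cast (NeZero.one_le : 1 ≤ L)
  have hsmall : 2 * (2 * ((d : ℝ) + 1) * ((0 : ℝ) * L) ^ 2 + a * (Real.exp 0 - 1)) ≤ (min 2 a / (L : ℝ) ^ (d + 1)) / 2 := by
    rw [Real.exp_zero, sub_self, mul_zero, zero_mul, zero_pow two_ne_zero, mul_zero, add_zero, mul_zero]
    have : 0 < min 2 a := lt_min two_pos ha
    positivity
  exact (twoCutoff_inv_decay hn (fineBox_isBlockUnion hn NeZero.one_le M) ha le_rfl zero_le_one hsmall hs0 hs1 x x).1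

/-- **THE TORUS LINE IS INVERTIBLE** for `a > 0`, `s ∈ [0,1]`: its √s-extension is `min(2,a)∕L^{d+1}`-coercive (run A's floor
`lower18_zero` + domination for the coarse operator, `coercive_congr` + domination for the torus chart operator). [folklore] -/
theorem isUnit_det_torLine (hn : 1 ≤ n) {a : ℝ} (ha : 0 < a) (hM : ∀ i, 1 ≤ M i) {s : ℝ} (hs0 : 0 ≤ s) (hs1 : s ≤ 1) :
    IsUnit (torLine (isBlockUnion_fine (fineTor_isBlockUnion hn (NeZero.one_le : 1 ≤ L) M)) n a (fun i => n * L * M i)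
      (fun i => n * M i) s).det := by
  have hL : 1 ≤ L := NeZero.one_le
  have hnL : 1 ≤ n * L := one_le_mul hn hL
  have hNc : ∀ i, 1 ≤ (fun i => n * M i) i := mul_pos_side hn hM
  have hNf : ∀ i, 1 ≤ (fun i => n * L * M i) i := mul_pos_side hnL hM
  set hT' := fineTor_isBlockUnion hn hL M
  have hTL : IsBlockUnion L (boxDom (dbl fun i => n * L * M i)) := isBlockUnion_fine hT'
  have hTc : IsBlockUnion n ((boxDom (dbl fun i => n * L * M i)).image (blk L)) := isBlockUnion_coarse hL hT'
  have hLpow : (0 : ℝ) < (L : ℝ) ^ (d + 1) := pow_pos (by exact_mod_cast hL) _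
  have hLpow1 : (1 : ℝ) ≤ (L : ℝ) ^ (d + 1) := one_le_pow₀ (by exact_mod_cast hL)
  have hmin : 0 < min 2 a := lt_min two_pos ha
  set σ : ℝ := min 2 a / (L : ℝ) ^ (d + 1) with hσdef
  have hσ : 0 < σ := div_pos hmin hLpow
  have hσle : σ ≤ min 2 a := div_le_self hmin.le hLpow1
  -- (1) the coarse periodic operator dominates run A's floor
  have hP₀ : ∀ g : ↥((boxDom (dbl fun i => n * L * M i)).image (blk L)) → ℝ,
      σ * (g ⬝ᵥ g) ≤ g ⬝ᵥ (torOpK n a (fun i => n * M i) ((boxDom (dbl fun i => n * L * M i)).image (blk L))).mulVec g := by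
    intro g
    have hg : 0 ≤ g ⬝ᵥ g := Finset.sum_nonneg fun _ _ => mul_self_nonneg _
    exact (mul_le_mul_of_nonneg_right hσle hg).trans
      ((lower18_zero hn ha.le hTc g).trans (form_torOpK_ge n a hNc (image_fineTor hL n M) g))
  -- (2) the torus chart operator dominates run B's floor
  have hH₁ : ∀ u, σ * (u ⬝ᵥ u) ≤ u ⬝ᵥ (torB hTL n a (fun i => n * L * M i)).mulVec u := by
    intro u
    have h := coercive_congr (coordT hTL) (torOpK (n * L) a (fun i => n * L * M i) (boxDom (dbl fun i => n * L * M i)))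
      (c := ((L : ℝ) ^ (d + 1))⁻¹) (σM := min 2 a) (cT := 1) (by positivity) hmin.le
      (fun φ => (lower18_zero hnL ha.le hT' φ).trans (form_torOpK_ge (n * L) a hNf rfl φ)) (dot_le_coordT hTL) u
    have hσ' : ((L : ℝ) ^ (d + 1))⁻¹ * min 2 a * 1 = σ := by rw [hσdef]; field_simp
    rw [hσ'] at h
    exact h
  have hH₁' : ∀ u, σ * (u ⬝ᵥ u) ≤ u ⬝ᵥ (fromBlocks (torB hTL n a (fun i => n * L * M i)).toBlocks₁₁
      (torB hTL n a (fun i => n * L * M i)).toBlocks₁₂ (torB hTL n a (fun i => n * L * M i)).toBlocks₂₁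
      (torB hTL n a (fun i => n * L * M i)).toBlocks₂₂).mulVec u := by
    intro u; rw [fromBlocks_toBlocks]; exact hH₁ u
  have hE := isUnit_det_of_coercive _ hσ (coercive_extOpR _ _ _ _ _ hP₀ hH₁' hs0 hs1)
  unfold torLine
  exact isUnit_det_lineOpR_of_extOpR _ _ _ _ _ hs0 (isUnit_det_torB_fluct hn hT' rfl hNf ha.le) hE

/-- **THE PROPAGATORS FOLD**: `G^Π(s)(fold x₀, y) = Σ_{x ∈ 𝕋, fold x = y} G^𝕋(s)(x₀, x)` for `a > 0`, `s ∈ [0,1]` — B4 (2.42)'s method of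
images for the whole two-cutoff line, in the finite doubled-torus form. [folklore] -/
theorem twoCutoffLine_inv_fold_apply (hn : 1 ≤ n) {a : ℝ} (ha : 0 < a) (hM : ∀ i, 1 ≤ M i) {s : ℝ} (hs0 : 0 ≤ s)
    (hs1 : s ≤ 1) (x₀ : ↥((boxDom (dbl fun i => n * L * M i)).image (blk L)))
    (y : ↥((boxDom fun i => n * L * M i).image (blk L))) :
    (twoCutoffLine (isBlockUnion_fine (fineBox_isBlockUnion hn (NeZero.one_le : 1 ≤ L) M)) n a s)⁻¹
        ⟨foldBox (fun i => n * M i) x₀.1, foldBox_mem_image hn hM x₀.1⟩ y =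
      ∑ x ∈ Finset.univ.filter (fun x : ↥((boxDom (dbl fun i => n * L * M i)).image (blk L)) =>
          foldBox (fun i => n * M i) x.1 = y.1),
        (torLine (isBlockUnion_fine (fineTor_isBlockUnion hn (NeZero.one_le : 1 ≤ L) M)) n a (fun i => n * L * M i)
          (fun i => n * M i) s)⁻¹ x₀ x := by
  classical
  set f : ↥((boxDom (dbl fun i => n * L * M i)).image (blk L)) → ↥((boxDom fun i => n * L * M i).image (blk L)) :=
    fun x => ⟨foldBox (fun i => n * M i) x.1, foldBox_mem_image hn hM x.1⟩ with hf
  have hE : unfoldM (fun i => n * M i) ((boxDom (dbl fun i => n * L * M i)).image (blk L))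
      ((boxDom fun i => n * L * M i).image (blk L)) = Matrix.of fun x y => if f x = y then (1 : ℝ) else 0 := by
    ext x y'
    simp only [unfoldM_apply, Matrix.of_apply, hf, Subtype.ext_iff]
  have h := inv_intertwine (torLine_mul_unfoldM hn ha.le hM s (L := L)) (isUnit_det_twoCutoffLine hn ha M hs0 hs1 y)
    (isUnit_det_torLine hn ha hM hs0 hs1)
  rw [hE] at h
  have h2 := apply_fold_eq_sum_of_intertwine f h x₀ y
  rw [show f x₀ = ⟨foldBox (fun i => n * M i) x₀.1, foldBox_mem_image hn hM x₀.1⟩ from rfl] at h2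
  rw [h2]
  refine Finset.sum_congr (Finset.filter_congr fun x _ => ?_) fun _ _ => rfl
  rw [hf, Subtype.ext_iff]

end Green

end Summit.QuantumFields.BalabanUV.T4Continuum.NE7K1LinSchurFoldBox

end
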